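import Mathlib.NumberTheory.NumberField.Discriminant.Basic
import Mathlib.FieldTheory.Galois.Basic
import Mathlib.FieldTheory.IsAlgClosed.AlgebraicClosure
import Mathlib.Analysis.SpecialFunctions.Log.Basic
import Mathlib.Algebra.BigOperators.Finprod
import Literature.NumberTheory.EllipticCurves.MordellWeil
import HarnessLib

/-!
# Smith, *The distribution of `ℓ^∞`-Selmer groups in degree `ℓ` twist families II*, Theorem 1.1:
# exponential moments of the rank over cyclic degree-`ℓ` extensions (bounded average rank)

A. Smith, part II = J. Amer. Math. Soc. **39** (2026), no. 2, 453–514 (doi:10.1090/jams/1063) =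
arXiv:2207.05143v2 [Smi22b], §1, **Theorem 1.1** (REFEREED; wording of arXiv v2):

> Take `ℓ` to be a rational prime, take `F` to be a number field, and take `A` to be an abelian
> variety over `F`. For any `H > 0`, take `X(H)` to be the set of cyclic degree `ℓ` extensions `K`
> of `F` for which the absolute discriminant of `K` is at most `H`. Then there are real numbers
> `c, C > 0` depending on `A/F` and `ℓ` so, for any `m > 0` and `H > C` satisfying
> `m < c · log log log H`, we have `∑_{K ∈ X(H)} exp(m · rank(A/K)) ≤ exp(C m²) · #X(H)`.

("Our unconditional result is a consequence of Theorem 2.6, as we will see in Example 3.9";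
abstract: "Along the way, we show that the average rank in the quadratic twist family of any given
abelian variety over a number field is bounded" — for `ℓ = 2`, `K = F(√d)`, by (3.4)
`rank(A/K) = rank(A/F) + rank(A^d/F)`; over `ℚ` the tree has this identity as
`mordellWeilRank_baseChange_of_finrank_eq_two`.)

Transcription. The tree has no abelian varieties: the fact is vendored for ELLIPTIC CURVES
`A : WeierstrassCurve F` (`-- TODO(general form)` below). "Cyclic degree `ℓ` extensions `K` of `F`"
are counted as subfields of a fixed algebraic closure — `K : IntermediateField F F̄` with
`[K : F] = ℓ`, `K/F` Galois with cyclic group (for prime `ℓ` "Galois of degree `ℓ`" already forces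
this; each `F`-isomorphism class of such `K` occurs exactly once in `F̄`); the "absolute
discriminant of `K`" is `|NumberField.discr K|` (`cyclicExtAbsDiscr`, the `NumberField` structure on
`K` being built from `[K : F] < ∞`); `rank(A/K)` = `(A.baseChange K).mordellWeilRank`
(`rankOver`); `X(H)` = `cyclicExtensionsOfAbsDiscrLe F ℓ H`, a finite set (Hermite), summed with
`finsum`. PROVED: `cyclicExtensionsOfAbsDiscrLe_finite` (Hermite, via Mathlib's
`NumberField.finite_of_discr_bdd`) and, from the fact, `sum_rankOver_le_of_rankExpMoment` — for `H`
beyond an explicit threshold the AVERAGE of `rank(A/K)` over `K ∈ X(H)` is at most `exp C`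
(take `m = 1`, `rank ≤ exp(rank)`), the "bounded average rank" of the abstract in its
family-over-`K` form.

## References

* [Smith2026SelmerTwistII] A. Smith, J. Amer. Math. Soc. 39 (2026) 453–514 = arXiv:2207.05143v2:
  Thm. 1.1 (p. 2), abstract, Example 3.9 and display (3.4) (p. 15), Thm. 2.6.
-/

noncomputable section

open scoped Classical
open Filter Topology

namespace Literature.NumberTheory.EllipticCurves

open WeierstrassCurve

section Family

variable (F : Type) [Field F]

variable {F} in
/-- `rank(A/K)`, the Mordell–Weil rank of `A` over the extension `K ⊆ F̄`
(`WeierstrassCurve.mordellWeilRank` of the base change). [cite: Smith2026SelmerTwistII, Thm. 1.1] -/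
def rankOver (A : WeierstrassCurve F) (K : IntermediateField F (AlgebraicClosure F)) : ℕ :=
  (A.baseChange K).mordellWeilRank

variable [NumberField F]

/-- The absolute discriminant `|Δ_K|` of a subextension `K` of `F̄/F` of finite degree (a number
field: `NumberField.of_module_finite`), as a natural number; junk `0` for infinite `[K : F]`.
[cite: Smith2026SelmerTwistII, Thm. 1.1 ("the absolute discriminant of `K`")] -/
def cyclicExtAbsDiscr (K : IntermediateField F (AlgebraicClosure F)) : ℕ :=
  if h : FiniteDimensional F K then
    haveI := h
    haveI : NumberField K := NumberField.of_module_finite F K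
    (NumberField.discr K).natAbs
  else 0

/-- **`X(H)`** (Smith, part II, Thm. 1.1): "the set of cyclic degree `ℓ` extensions `K` of `F` for
which the absolute discriminant of `K` is at most `H`", realised inside a fixed algebraic closure
`F̄`: intermediate fields `K` with `[K : F] = ℓ`, `K/F` Galois with cyclic Galois group, and
`|Δ_K| ≤ H` (each `F`-isomorphism class of such extensions occurs exactly once in `F̄`, being
Galois). A finite set: `cyclicExtensionsOfAbsDiscrLe_finite` (Hermite).
[cite: Smith2026SelmerTwistII, Thm. 1.1] -/
def cyclicExtensionsOfAbsDiscrLe (ℓ : ℕ) (H : ℝ) :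
    Set (IntermediateField F (AlgebraicClosure F)) :=
  {K | Module.finrank F K = ℓ ∧ IsGalois F K ∧ IsCyclic (K ≃ₐ[F] K) ∧
    (cyclicExtAbsDiscr F K : ℝ) ≤ H}

end Family

/-- **Smith, J. Amer. Math. Soc. 39 (2026) 453–514 (part II), Theorem 1.1 — elliptic-curve case.**
"Take `ℓ` to be a rational prime, take `F` to be a number field, and take `A` to be an abelian
variety over `F`. … Then there are real numbers `c, C > 0` depending on `A/F` and `ℓ` so, for any
`m > 0` and `H > C` satisfying `m < c · log log log H`, we have
`∑_{K ∈ X(H)} exp(m · rank(A/K)) ≤ exp(C m²) · #X(H)`." Vendored for `A` an elliptic curve over `F`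
(a Weierstrass model `A : WeierstrassCurve F`); `X(H) = cyclicExtensionsOfAbsDiscrLe F ℓ H`,
`rank(A/K) = rankOver A K`, the sum as a `finsum` over the (finite) set `X(H)`. REFEREED.
[cite: Smith2026SelmerTwistII, Thm. 1.1 (with Thm. 2.6 and Example 3.9)] -/
def smith2026_rankExpMoment_cyclicExtensions : Prop :=
  -- TODO(general form): the source states this for every abelian variety `A/F`; the tree has no
  -- abelian varieties of dimension `> 1`.
  ∀ (ℓ : ℕ), ℓ.Prime → ∀ (F : Type) [Field F] [NumberField F] (A : WeierstrassCurve F) [A.IsElliptic],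
    ∃ c C : ℝ, 0 < c ∧ 0 < C ∧
      ∀ (m H : ℝ), 0 < m → C < H → m < c * Real.log (Real.log (Real.log H)) →
        ∑ᶠ K ∈ cyclicExtensionsOfAbsDiscrLe F ℓ H, Real.exp (m * (rankOver A K : ℝ)) ≤
          Real.exp (C * m ^ 2) * Nat.card (cyclicExtensionsOfAbsDiscrLe F ℓ H)

/-! ## API and the bounded-average-rank corollary -/

section API

variable {F : Type} [Field F]

/-- Unfolding `rankOver`. [cite: Smith2026SelmerTwistII, Thm. 1.1] -/
theorem rankOver_eq (A : WeierstrassCurve F) (K : IntermediateField F (AlgebraicClosure F)) :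
    rankOver A K = (A.baseChange K).mordellWeilRank :=
  rfl

variable [NumberField F]

/-- Membership in `X(H)`. [cite: Smith2026SelmerTwistII, Thm. 1.1] -/
theorem mem_cyclicExtensionsOfAbsDiscrLe_iff (ℓ : ℕ) (H : ℝ)
    (K : IntermediateField F (AlgebraicClosure F)) :
    K ∈ cyclicExtensionsOfAbsDiscrLe F ℓ H ↔
      Module.finrank F K = ℓ ∧ IsGalois F K ∧ IsCyclic (K ≃ₐ[F] K) ∧
        (cyclicExtAbsDiscr F K : ℝ) ≤ H :=
  Iff.rfl

/-- `X(H)` is monotone in `H`. [cite: Smith2026SelmerTwistII, Thm. 1.1] -/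
theorem cyclicExtensionsOfAbsDiscrLe_mono (ℓ : ℕ) {H H' : ℝ} (h : H ≤ H') :
    cyclicExtensionsOfAbsDiscrLe F ℓ H ⊆ cyclicExtensionsOfAbsDiscrLe F ℓ H' :=
  fun _ hK ↦ ⟨hK.1, hK.2.1, hK.2.2.1, hK.2.2.2.trans h⟩

/-- The value of `cyclicExtAbsDiscr` on a finite subextension. [cite: Smith2026SelmerTwistII, Thm. 1.1] -/
theorem cyclicExtAbsDiscr_of_finiteDimensional (K : IntermediateField F (AlgebraicClosure F))
    (h : FiniteDimensional F K) :
    cyclicExtAbsDiscr F K =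
      (haveI := h; haveI : NumberField K := NumberField.of_module_finite F K;
        (NumberField.discr K).natAbs) := by
  rw [cyclicExtAbsDiscr, dif_pos h]

/-- Auxiliary map to the parameter space of Mathlib's Hermite theorem
(`NumberField.finite_of_discr_bdd`): a finite subextension `K` of `F̄/F`, viewed as a
finite-dimensional intermediate field of `F̄/ℚ` (junk `⊥` for infinite `[K : F]`). [folklore] -/
private def toRatIntermediateField (K : IntermediateField F (AlgebraicClosure F)) :
    {E : IntermediateField ℚ (AlgebraicClosure F) // FiniteDimensional ℚ E} :=
  if h : FiniteDimensional F K then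
    ⟨K.restrictScalars ℚ, by
      haveI := h
      have : FiniteDimensional ℚ K := Module.Finite.trans F K
      exact this⟩
  else ⟨⊥, by infer_instance⟩

/-- On a finite subextension the auxiliary map is `K ↦ K` viewed over `ℚ`. [folklore] -/
private theorem toRatIntermediateField_of_fd
    (K : IntermediateField F (AlgebraicClosure F)) (h : FiniteDimensional F K) :
    (toRatIntermediateField K).1 = K.restrictScalars ℚ := by
  rw [toRatIntermediateField, dif_pos h]

/-- **Hermite:** inside `F̄` there are only finitely many subextensions of `F` of a given finite
degree `ℓ ≥ 1` and bounded absolute discriminant (Mathlib's `NumberField.finite_of_discr_bdd`,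
transported along `K ↦ K` viewed over `ℚ`). [folklore] -/
private theorem finite_setOf_finrank_eq_absDiscr_le {ℓ : ℕ} (hℓ : ℓ ≠ 0) (N : ℕ) :
    {K : IntermediateField F (AlgebraicClosure F) |
      Module.finrank F K = ℓ ∧ cyclicExtAbsDiscr F K ≤ N}.Finite := by
  have hHer := NumberField.finite_of_discr_bdd (AlgebraicClosure F) N
  refine Set.Finite.of_finite_image (f := toRatIntermediateField) (hHer.subset ?_) ?_
  · rintro _ ⟨K, ⟨hK, hd⟩, rfl⟩
    rw [Set.mem_setOf_eq]
    have hfd : FiniteDimensional F K :=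
      Module.finite_of_finrank_pos (Nat.pos_of_ne_zero (hK ▸ hℓ :))
    rw [cyclicExtAbsDiscr_of_finiteDimensional K hfd] at hd
    have hd' : (haveI := hfd; haveI : NumberField K := NumberField.of_module_finite F K;
        |NumberField.discr K| ≤ (N : ℤ)) := by
      rw [← Int.natCast_natAbs]
      exact_mod_cast hd
    have key : ∀ E : {E : IntermediateField ℚ (AlgebraicClosure F) // FiniteDimensional ℚ E},
        E.1 = K.restrictScalars ℚ →
        (haveI : NumberField E.1 := @NumberField.mk _ _ inferInstance E.prop;
          |NumberField.discr E.1| ≤ (N : ℤ)) := by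
      rintro ⟨E, hE⟩ rfl
      exact hd'
    exact key _ (toRatIntermediateField_of_fd K hfd)
  · intro K hK K' hK' hKK'
    have hfd : FiniteDimensional F K :=
      Module.finite_of_finrank_pos (Nat.pos_of_ne_zero (hK.1 ▸ hℓ :))
    have hfd' : FiniteDimensional F K' :=
      Module.finite_of_finrank_pos (Nat.pos_of_ne_zero (hK'.1 ▸ hℓ :))
    have h := congrArg Subtype.val hKK'
    rw [toRatIntermediateField_of_fd K hfd, toRatIntermediateField_of_fd K' hfd'] at h
    exact IntermediateField.restrictScalars_injective ℚ h

/-- **`X(H)` is finite** for `ℓ ≥ 1` (Hermite's theorem: finitely many number fields of bounded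
degree and discriminant inside `F̄`; Mathlib `NumberField.finite_of_discr_bdd`).
[cite: Smith2026SelmerTwistII, Thm. 1.1 (`#X(H)`)] -/
theorem cyclicExtensionsOfAbsDiscrLe_finite {ℓ : ℕ} (hℓ : ℓ ≠ 0) (H : ℝ) :
    (cyclicExtensionsOfAbsDiscrLe F ℓ H).Finite := by
  refine (finite_setOf_finrank_eq_absDiscr_le hℓ ⌊max H 0⌋₊).subset ?_
  rintro K ⟨hK, -, -, hd⟩
  refine ⟨hK, Nat.le_floor ?_⟩
  exact hd.trans (le_max_left _ _)

/-- A natural number is at most the exponential of itself (`n ≤ n + 1 ≤ e^n`). [folklore] -/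
private theorem natCast_le_exp (n : ℕ) : (n : ℝ) ≤ Real.exp n := by
  have := Real.add_one_le_exp (n : ℝ)
  linarith

/-- **Bounded average rank over cyclic degree-`ℓ` extensions** (the "average rank … is bounded"
of the abstract of part II, in its family-over-`K` form; PROVED from Thm. 1.1 and Hermite): with
`c, C` the constants of Thm. 1.1 for `(ℓ, F, A)`, for every `H > max(C, exp exp exp (2/c))` (so that
`m = 1` is admissible: `1 < 2 ≤ c · log log log H`) one has `∑_{K ∈ X(H)} rank(A/K) ≤ e^C · #X(H)`,
using `rank ≤ exp(rank)` termwise over the finite set `X(H)`.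
[cite: Smith2026SelmerTwistII, Thm. 1.1 and abstract ("the average rank … is bounded")] -/
theorem sum_rankOver_le_of_rankExpMoment (h : smith2026_rankExpMoment_cyclicExtensions)
    {ℓ : ℕ} (hℓ : ℓ.Prime) (A : WeierstrassCurve F) [A.IsElliptic] :
    ∃ B C' : ℝ, 0 < B ∧ ∀ H : ℝ, C' < H →
      ∑ᶠ K ∈ cyclicExtensionsOfAbsDiscrLe F ℓ H, (rankOver A K : ℝ) ≤
        B * Nat.card (cyclicExtensionsOfAbsDiscrLe F ℓ H) := by
  obtain ⟨c, C, hc, hC, hmain⟩ := h ℓ hℓ F A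
  refine ⟨Real.exp (C * 1 ^ 2), max C (Real.exp (Real.exp (Real.exp (2 / c)))), Real.exp_pos _,
    fun H hH ↦ ?_⟩
  have hCH : C < H := lt_of_le_of_lt (le_max_left _ _) hH
  have hEH : Real.exp (Real.exp (Real.exp (2 / c))) < H := lt_of_le_of_lt (le_max_right _ _) hH
  -- `m = 1` is admissible: `1 < c · log log log H`
  have hm : (1 : ℝ) < c * Real.log (Real.log (Real.log H)) := by
    have h1 : Real.exp (Real.exp (2 / c)) < Real.log H := by
      rw [Real.lt_log_iff_exp_lt (lt_trans (Real.exp_pos _) hEH)]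
      exact hEH
    have h2 : Real.exp (2 / c) < Real.log (Real.log H) := by
      rw [Real.lt_log_iff_exp_lt (lt_trans (Real.exp_pos _) h1)]
      exact h1
    have h3 : 2 / c < Real.log (Real.log (Real.log H)) := by
      rw [Real.lt_log_iff_exp_lt (lt_trans (Real.exp_pos _) h2)]
      exact h2
    have h4 : c * (2 / c) < c * Real.log (Real.log (Real.log H)) := mul_lt_mul_of_pos_left h3 hc
    rw [mul_div_cancel₀ _ hc.ne'] at h4
    linarith
  have hsum := hmain 1 H one_pos hCH hm
  simp only [one_mul] at hsum
  refine le_trans ?_ hsum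
  have hfin := cyclicExtensionsOfAbsDiscrLe_finite (F := F) hℓ.ne_zero H
  rw [finsum_mem_eq_finite_toFinset_sum _ hfin, finsum_mem_eq_finite_toFinset_sum _ hfin]
  exact Finset.sum_le_sum fun K _ ↦ natCast_le_exp _

end API

end Literature.NumberTheory.EllipticCurves

end
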